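import Mathlib
import Literature.NumberTheory.Transcendental.KZRulesAssociator
import Summits.KontsevichZagierPeriods.KontsevichZagierPeriods.Theorems.SoloInformedZetaFourGarland
import HarnessLib
import HarnessLib.Audit

/-!
# SoloInformed — weight 4: the garland pieces are `ζ(2,2)`, `ζ(3,1)`, `ζ(3,1)`

Solo programme `solo-KontsevichZagierPeriods-informed`, session s45 (PART XVI). The three pieces
`G_a, G_b, G_c` of the garland representation (`SoloInformedZetaFourGarland`) are identified, by
COORDINATE PERMUTATIONS (rule (2), `KZ.of_sub_of_reindex_mem_relations`), with Kontsevich's simplex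
representations `KZ.mzvRep` of the Literature (domain `KZ.openOrderedSimplex 4 =
{1 > t₀ > t₁ > t₂ > t₃ > 0}`, integrand read off the binary word, convention `n₁ > n₂` of
`multipleZeta`):

* `G_a = [t₀ > t₃ > t₁ > t₂, 1/(t₀t₁(1−t₂)(1−t₃))] ≡ mzvRep [2,2]` (word `0101`),
* `G_b = [t₀ > t₁ > t₃ > t₂, 1/(t₀t₁(1−t₂)(1−t₃))] ≡ mzvRep [3,1]` (word `0011`),
* `G_c = [∇⁴, 1/(t₀t₁(1−t₂)(1−t₃))] ≡ mzvRep [3,1]`.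

Also: `KZ.openOrderedSimplex 4 = soloInformedOrdSimplex 4 = ∇⁴` (chain form) and the explicit
integrands of `mzvRep [3,1]`, `[2,2]`, `[4]`.

References: Kontsevich–Zagier 2001 §1.1–1.2 [KontsevichZagier2001]; Zagier 1994 §9 [Zagier1994].
-/

noncomputable section

open MeasureTheory Set MvPolynomial
open Literature.ModelTheory.ExponentialFields Literature.NumberTheory.Transcendental
open Literature.NumberTheory.Transcendental.KZ

namespace Summit.KontsevichZagierPeriods.KontsevichZagierPeriods.Theorems

/-! ## 1. The simplex in its three guises -/

/-- `KZ.openOrderedSimplex 4 = ∇⁴` (chain form). -/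
theorem soloInformed_openOrderedSimplex4_eq : openOrderedSimplex 4 = soloInformedNabla4 := by
  ext t
  rw [soloInformed_mem_nabla4]
  simp only [openOrderedSimplex, soloInformedOpenCube, mem_setOf_eq]
  constructor
  · rintro ⟨h0, h1, hs⟩
    exact ⟨fun j => ⟨h0 j, h1 j⟩, hs (by decide : (0 : Fin 4) < 1), hs (by decide : (1 : Fin 4) < 2),
      hs (by decide : (2 : Fin 4) < 3)⟩
  · rintro ⟨hc, h10, h21, h32⟩
    refine ⟨fun j => (hc j).1, fun j => (hc j).2, Fin.strictAnti_iff_succ_lt.2 fun i => ?_⟩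
    fin_cases i
    · simpa using h10
    · simpa using h21
    · simpa using h32

/-- `soloInformedOrdSimplex 4 = KZ.openOrderedSimplex 4`. -/
theorem soloInformed_ordSimplex4_eq : soloInformedOrdSimplex 4 = openOrderedSimplex 4 := by
  ext t
  exact ⟨fun h => ⟨fun j => (h.1 j).1, fun j => (h.1 j).2, fun a b hab => h.2 hab⟩,
    fun h => ⟨fun j => ⟨h.1 j, h.2.1 j⟩, fun a b hab => h.2.2 hab⟩⟩

/-! ## 2. The simplex representations of `ζ(3,1)`, `ζ(2,2)`, `ζ(4)` from the Literature -/


/-- **`Z(3,1) = KZ.mzvRep [3,1]`** = `[∇⁴, dt₀/t₀ · dt₁/t₁ · dt₂/(1−t₂) · dt₃/(1−t₃)]`. -/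
def soloInformedZ31 : IntegralRep 4 :=
  mzvRep [3, 1] (by decide : MZV.IsAdmissible [3, 1]) (mzvIntegrand_isSemialgebraicFunOn_holds _)
    (mzvIntegrand_integrableOn_holds _ (by decide : MZV.IsAdmissible [3, 1]))
/-- **`Z(2,2) = KZ.mzvRep [2,2]`** (word `0101`). -/
def soloInformedZ22 : IntegralRep 4 :=
  mzvRep [2, 2] (by decide : MZV.IsAdmissible [2, 2]) (mzvIntegrand_isSemialgebraicFunOn_holds _)
    (mzvIntegrand_integrableOn_holds _ (by decide : MZV.IsAdmissible [2, 2]))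
/-- **`Z(4) = KZ.mzvRep [4]`** (word `0001`). -/
def soloInformedZ4 : IntegralRep 4 :=
  mzvRep [4] (by decide : MZV.IsAdmissible [4]) (mzvIntegrand_isSemialgebraicFunOn_holds _)
    (mzvIntegrand_integrableOn_holds _ (by decide : MZV.IsAdmissible [4]))

/-- `⟦Z(3,1)⟧ = mzvClass [3,1]`. -/
theorem soloInformed_toFormalPeriod_Z31 : toFormalPeriod (of soloInformedZ31) = mzvClass [3, 1] :=
  (mzvClass_of_isAdmissible (by decide : MZV.IsAdmissible [3, 1])).symm
/-- `⟦Z(2,2)⟧ = mzvClass [2,2]`. -/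
theorem soloInformed_toFormalPeriod_Z22 : toFormalPeriod (of soloInformedZ22) = mzvClass [2, 2] :=
  (mzvClass_of_isAdmissible (by decide : MZV.IsAdmissible [2, 2])).symm
/-- `⟦Z(4)⟧ = mzvClass [4]`. -/
theorem soloInformed_toFormalPeriod_Z4 : toFormalPeriod (of soloInformedZ4) = mzvClass [4] :=
  (mzvClass_of_isAdmissible (by decide : MZV.IsAdmissible [4])).symm

/-- Domains. -/
@[simp] theorem soloInformedZ31_domain : soloInformedZ31.domain = openOrderedSimplex 4 := rfl
/-- Auxiliary. -/
@[simp] theorem soloInformedZ22_domain : soloInformedZ22.domain = openOrderedSimplex 4 := rfl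
/-- Auxiliary. -/
@[simp] theorem soloInformedZ4_domain : soloInformedZ4.domain = openOrderedSimplex 4 := rfl

/-- The integrand of `Z(3,1)`. -/
theorem soloInformedZ31_integrand (t : Fin 4 → ℝ) :
    soloInformedZ31.integrand t = 1 / t 0 * (1 / t 1) * (1 / (1 - t 2)) * (1 / (1 - t 3)) := by
  show ∏ i : Fin 4, mzvForm ((MZV.binaryWord [3, 1]).getD i false) (t i) = _
  rw [Fin.prod_univ_four, show MZV.binaryWord [3, 1] = [false, false, true, true] from rfl]
  simp [mzvForm]

/-- The integrand of `Z(2,2)`. -/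
theorem soloInformedZ22_integrand (t : Fin 4 → ℝ) :
    soloInformedZ22.integrand t = 1 / t 0 * (1 / (1 - t 1)) * (1 / t 2) * (1 / (1 - t 3)) := by
  show ∏ i : Fin 4, mzvForm ((MZV.binaryWord [2, 2]).getD i false) (t i) = _
  rw [Fin.prod_univ_four, show MZV.binaryWord [2, 2] = [false, true, false, true] from rfl]
  simp [mzvForm]

/-- The integrand of `Z(4)`. -/
theorem soloInformedZ4_integrand (t : Fin 4 → ℝ) :
    soloInformedZ4.integrand t = 1 / t 0 * (1 / t 1) * (1 / t 2) * (1 / (1 - t 3)) := by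
  show ∏ i : Fin 4, mzvForm ((MZV.binaryWord [4]).getD i false) (t i) = _
  rw [Fin.prod_univ_four, show MZV.binaryWord [4] = [false, false, false, true] from rfl]
  simp [mzvForm]

/-! ## 3. `G_c ≡ Z(3,1)` (same representation up to the shape of the domain) -/

/-- **`[G_c] − [Z(3,1)] ∈ relations`** (equal domains, equal integrands). -/
theorem soloInformed_gc_sub_Z31 : of soloInformedGcRep - of soloInformedZ31 ∈ relations :=
  of_sub_of_mem_relations_of_eqOn
    (by rw [soloInformedZ31_domain, soloInformedGcRep_domain, soloInformed_openOrderedSimplex4_eq])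
    fun t _ => by
      rw [soloInformedGcRep_integrand, soloInformedZ31_integrand, soloInformedZ31f, one_div_mul_one_div,
        one_div_mul_one_div, one_div_mul_one_div]

/-! ## 4. Coordinate permutations: `G_a ≡ Z(2,2)`, `G_b ≡ Z(3,1)` -/

/-- Relabelling the coordinates of a point of the cube keeps it in the cube. -/
theorem soloInformed_comp_mem_openCube_iff {m : ℕ} (e : Fin m ≃ Fin m) (w : Fin m → ℝ) :
    (fun i => w (e i)) ∈ soloInformedOpenCube m ↔ w ∈ soloInformedOpenCube m :=
  ⟨fun h j => by simpa using h (e.symm j), fun h j => h (e j)⟩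

/-- The permutation `(0,1,2,3) ↦ (0,2,3,1)` sorting `𝒢_a`. -/
def soloInformedPermA : Fin 4 ≃ Fin 4 := ⟨![0, 2, 3, 1], ![0, 3, 1, 2], by decide, by decide⟩
/-- The permutation `(0,1,2,3) ↦ (0,1,3,2)` sorting `𝒢_b`. -/
def soloInformedPermB : Fin 4 ≃ Fin 4 := ⟨![0, 1, 3, 2], ![0, 1, 3, 2], by decide, by decide⟩

/-- Values of the permutations. -/
@[simp] theorem soloInformedPermA_zero : soloInformedPermA 0 = 0 := rfl
/-- Auxiliary. -/
@[simp] theorem soloInformedPermA_one : soloInformedPermA 1 = 2 := rfl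
/-- Auxiliary. -/
@[simp] theorem soloInformedPermA_two : soloInformedPermA 2 = 3 := rfl
/-- Auxiliary. -/
@[simp] theorem soloInformedPermA_three : soloInformedPermA 3 = 1 := rfl
/-- Auxiliary. -/
@[simp] theorem soloInformedPermB_zero : soloInformedPermB 0 = 0 := rfl
/-- Auxiliary. -/
@[simp] theorem soloInformedPermB_one : soloInformedPermB 1 = 1 := rfl
/-- Auxiliary. -/
@[simp] theorem soloInformedPermB_two : soloInformedPermB 2 = 3 := rfl
/-- Auxiliary. -/
@[simp] theorem soloInformedPermB_three : soloInformedPermB 3 = 2 := rfl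

/-- The reindexed domain of `G_a` is the simplex. -/
theorem soloInformed_reindexA_domain :
    (soloInformedGaRep.reindex soloInformedPermA).domain = openOrderedSimplex 4 := by
  rw [IntegralRep.reindex_domain, soloInformedGaRep_domain, soloInformed_openOrderedSimplex4_eq]
  ext w
  simp only [mem_setOf_eq, soloInformed_mem_Ga, soloInformed_mem_nabla4,
    soloInformed_comp_mem_openCube_iff, soloInformedPermA_zero, soloInformedPermA_one,
    soloInformedPermA_two, soloInformedPermA_three]

/-- The reindexed domain of `G_b` is the simplex. -/
theorem soloInformed_reindexB_domain :
    (soloInformedGbRep.reindex soloInformedPermB).domain = openOrderedSimplex 4 := by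
  rw [IntegralRep.reindex_domain, soloInformedGbRep_domain, soloInformed_openOrderedSimplex4_eq]
  ext w
  simp only [mem_setOf_eq, soloInformed_mem_Gb, soloInformed_mem_nabla4,
    soloInformed_comp_mem_openCube_iff, soloInformedPermB_zero, soloInformedPermB_one,
    soloInformedPermB_two, soloInformedPermB_three]

/-- **`[G_a] − [Z(2,2)] ∈ relations`** (the permutation `t ↦ (t₀, t₂, t₃, t₁)`). -/
theorem soloInformed_ga_sub_Z22 : of soloInformedGaRep - of soloInformedZ22 ∈ relations := by
  have h1 := of_sub_of_reindex_mem_relations soloInformedGaRep soloInformedPermA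
  have h2 : of (soloInformedGaRep.reindex soloInformedPermA) - of soloInformedZ22 ∈ relations :=
    of_sub_of_mem_relations_of_eqOn (by rw [soloInformedZ22_domain, soloInformed_reindexA_domain])
      fun w _ => by
        simp only [IntegralRep.reindex_integrand, soloInformedGaRep_integrand,
          soloInformedZ22_integrand, soloInformedZ31f, soloInformedPermA_zero, soloInformedPermA_one,
          soloInformedPermA_two, soloInformedPermA_three]
        rw [one_div_mul_one_div, one_div_mul_one_div, one_div_mul_one_div]
        congr 1
        ring
  have h : of soloInformedGaRep - of soloInformedZ22 = (of soloInformedGaRep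
      - of (soloInformedGaRep.reindex soloInformedPermA))
      + (of (soloInformedGaRep.reindex soloInformedPermA) - of soloInformedZ22) := by abel
  rw [h]
  exact relations.add_mem h1 h2

/-- **`[G_b] − [Z(3,1)] ∈ relations`** (the permutation `t ↦ (t₀, t₁, t₃, t₂)`). -/
theorem soloInformed_gb_sub_Z31 : of soloInformedGbRep - of soloInformedZ31 ∈ relations := by
  have h1 := of_sub_of_reindex_mem_relations soloInformedGbRep soloInformedPermB
  have h2 : of (soloInformedGbRep.reindex soloInformedPermB) - of soloInformedZ31 ∈ relations :=
    of_sub_of_mem_relations_of_eqOn (by rw [soloInformedZ31_domain, soloInformed_reindexB_domain])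
      fun w _ => by
        simp only [IntegralRep.reindex_integrand, soloInformedGbRep_integrand,
          soloInformedZ31_integrand, soloInformedZ31f, soloInformedPermB_zero, soloInformedPermB_one,
          soloInformedPermB_two, soloInformedPermB_three]
        rw [one_div_mul_one_div, one_div_mul_one_div, one_div_mul_one_div]
        congr 1
        ring
  have h : of soloInformedGbRep - of soloInformedZ31 = (of soloInformedGbRep
      - of (soloInformedGbRep.reindex soloInformedPermB))
      + (of (soloInformedGbRep.reindex soloInformedPermB) - of soloInformedZ31) := by abel
  rw [h]
  exact relations.add_mem h1 h2

/-- **The garland side assembled**: `[R₁] − ([Z(2,2)] + [Z(3,1)] + [Z(3,1)]) ∈ relations`. -/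
theorem soloInformed_R1_sub_mzv :
    of soloInformedZ4Datum.R1 - (of soloInformedZ22 + of soloInformedZ31 + of soloInformedZ31)
      ∈ relations := by
  have h : of soloInformedZ4Datum.R1 - (of soloInformedZ22 + of soloInformedZ31 + of soloInformedZ31)
      = (of soloInformedZ4Datum.R1 - of soloInformedGRep)
        + (of soloInformedGRep - (of soloInformedGaRep + of soloInformedGbRep + of soloInformedGcRep))
        + (of soloInformedGaRep - of soloInformedZ22) + (of soloInformedGbRep - of soloInformedZ31)
        + (of soloInformedGcRep - of soloInformedZ31) := by abel
  rw [h]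
  exact relations.add_mem (relations.add_mem (relations.add_mem (relations.add_mem
    soloInformed_g_moveA soloInformed_g_moveB) soloInformed_ga_sub_Z22) soloInformed_gb_sub_Z31)
    soloInformed_gc_sub_Z31

end Summit.KontsevichZagierPeriods.KontsevichZagierPeriods.Theorems
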